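import Summits.CriticalPhenomena.SAWScalingLimit.Theses.SAWConfRestriction

/-!
# `AssemblyTarget` (stmt-CriticalPhenomena-11213): LSW characterisation → target → `SAWScalingLimit` for `SAWConfRestriction`

Support item stmt-CriticalPhenomena-11213 of route `SAWConfRestriction` (frame statement #1, fact → X1 → Statement).  Given
the Lawler–Schramm–Werner characterisation by name (`Literature.Probability.RandomPlanarGeometry.LawlerSchrammWerner2003`,
a named fact taken as an antecedent — nothing is asserted about it here) and the route's target (a chordal family `P` with
(lim), (conf), (restr), (simple)), the fact gives `IsSLELaw (8/3) D (P D)` for every Dobrushin domain, i.e. `P D` is the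
push-forward of Wiener measure under a chordal SLE_{8/3} curve `Γ`; moving the test integrals of (lim) along `integral_map`
(the discrete side is measurable for the discrete σ-algebra, `SAW.aemeasurable_curve`) yields `ConvergesInLawToSLE (8/3)`,
i.e. `SAWScalingLimit`.  Same term as the route's certified deciding theorem `closes`, with the target's clauses read off.
[cite: LawlerSchrammWerner2003Restriction, Thm 8.4]
-/

namespace Summit.CriticalPhenomena.SAWScalingLimit.Theorems

open Summit.CriticalPhenomena.SAWScalingLimit.Theses

/-- **`AssemblyTarget` (stmt-CriticalPhenomena-11213)**: `LawlerSchrammWerner2003 → Target → SAWScalingLimit` for route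
`SAWConfRestriction`. [cite: LawlerSchrammWerner2003Restriction, Thm 8.4] -/
theorem ConfRestrictionAssemblyTarget_proof : SAWConfRestriction.AssemblyTarget := by
  intro hLSW hT
  obtain ⟨P, hch, hlim, hconf, hrestr, hsimple⟩ := hT
  have hsle : ∀ D : Literature.Probability.RandomPlanarGeometry.DobrushinDomain,
      Literature.Probability.RandomPlanarGeometry.IsSLELaw ((8 : NNReal) / 3) D (P D) :=
    hLSW P hch hconf hrestr hsimple
  intro D a b hab
  obtain ⟨Γ, hΓ, hPD⟩ := hsle D
  refine ⟨Γ, hΓ, Filter.Eventually.of_forall fun δ =>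
    Literature.Probability.RandomPlanarGeometry.SAW.aemeasurable_curve _ _ _ _, fun f => ?_⟩
  have h := hlim D a b hab f
  simp only [id_eq, hPD] at h
  rwa [MeasureTheory.integral_map hΓ.aemeasurable f.continuous.aestronglyMeasurable] at h

end Summit.CriticalPhenomena.SAWScalingLimit.Theorems
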